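import Summits.QuantumFields.YangMills.Theorems.BalabanUVNodesK0Stub1V0Reality
import Literature.MathematicalPhysics.QuantumFieldTheory.Balaban1983to89.B11Eq92CommutatorFunctional
import Literature.Analysis.SpecialFunctions.SpheroidalHarmonicBranch
import HarnessLib

/-!
# (R-V₀) brick V2c — THE ONE-BOND FUNCTIONALS OF `V′₀` AND OF THE (39)-TERM ARE REAL ON HERMITIAN DATA

Route `UnitScaleTilt`, crux EX `MinimiserStabilityRegPr` (stmt-QuantumFields-19200), display of record S13ᴰ, row `hV0` (the `V′₀`-current of
[Balaban1985Variational, (90) p.291] is `S`-valued, `S` = Hermitian traceless data); the REALITY half of the located plan (evidence `LOCATE-RV0-px3g3.md`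
§3(α)); its twin ✓`Prop7V0CurrentCentralDeriv` (V2b) is the «kills the centre» half.

For a unitary reading `U₀` (`U₀(b)⁻¹ = U₀(b)*`), a tracial `*`-compatible functional `τ` (`τ(ab) = τ(ba)`, `τ(a*) = conj τ(a)`) and a HERMITIAN-valued
configuration `B`, every plaquette functional of (39) is REAL: `conj V′₀(B, ∂p) = V′₀(B, ∂p)` (★`conj_V0primeP`).  Indeed, by the exact insertion formula
✓`B9Eq37Insertion.eq37_summand`, `V₀(B, ∂p) = η⁻⁴·[wil τ(Πe^{iηB′}·U₀(∂p)) − wil τ U₀(∂p) − η²τ(X·Im W) − ½η⁴τ(X²·Re W) − ½η²τ(iC·Im W)]` with every term real: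
the two Wilson terms by ✓`K0Stub1V0Reality.conj_wil` (`Πe^{iηB′}U₀(∂p)` is, under `τ`, the plaquette variable of the UNITARY product configuration
`e^{iηB}U₀`, ✓`B9Eq39Adjoint.wil_plaqU_prodCfg` + ✓`prodCfg_inv_eq_star`), the three coefficient traces by ✓`B9Eq37Insertion.coefficients_real` (Hermitian `X`,
anti-Hermitian commutator sum `C`, ✓`star_sum_commSum`); and the (39)-term `½ i τ((D^ηB)(p)·comm2)` is real because `(D^ηB)(p)` is Hermitian, `comm2` anti-Hermitian,
so `τ(Hermitian · anti-Hermitian)` is imaginary (★`conj_term39`).  Along a Hermitian one-bond line `A + t·δ_b Z` (`A` Hermitian-valued, `Z* = Z`, `t ∈ ℝ`,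
✓`B11Eq36Complex.star_line`) the entire functions `t ↦ V′₀(A + tδ_bZ, ∂q)`, `t ↦ term39(A + tδ_bZ, ∂q)` are therefore real on the real axis, so their
derivatives at `0` — the one-bond functionals (63)/(90) `dV0primeBond … Z` and (91)–(93) `dTerm39Bond … Z` — are REAL
(✓`Literature.Analysis.SpecialFunctions.im_deriv_eq_zero_of_real`): ★★`conj_dV0primeBond_apply`, ★`conj_dTerm39Bond_apply`.

USE (V3, assembly of `hV0`): with V2b's `dV0primeBond … (c·1) = 0` these are exactly the two hypotheses of ✓`Prop7SectET3WCurrentRealityLetters.hρ_rieszτ_frobEquiv`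
(`ℓ` real on `S`, `ℓ` zero on the centre ⟹ `ρ(ℓ) ∈ S`) for each one-bond functional `ℓ` of the currents (90)/(93) at the member.
Lit-balaban's own letters throughout; nothing restated.  Helper toward stmt-QuantumFields-19200 (`--supports`), def-free, sorry-free.
-/

noncomputable section

open NormedSpace Complex Filter

namespace Summit.QuantumFields.YangMills.Theorems.Prop7V0CurrentHermitianReality

open Literature.MathematicalPhysics.QuantumFieldTheory.Balaban1983to89
open Literature.MathematicalPhysics.QuantumFieldTheory.Balaban1983to89.Beta.TransportVertices (holonomy commSum)
open B9Eq39Adjoint (R lettersA sum_lettersA plaqU curl curlη rem3 prodCfg wil_plaqU_prodCfg)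
open B9Eq37Insertion (letters plaqD holU reC imC wil rem eq37_summand coefficients_real star_sum_commSum)
open Literature.MathematicalPhysics.QuantumFieldTheory.Balaban1983to89.Beta.AdjointTransportJets (invPath)
open B9Eq310Hermitian (star_R plaqU_unitary star_curlη star_eta_inv)
open B11Eq26ActionExpansion (V0p)
open B11Eq90StB (bondDelta)
open B11Eq36Complex (star_line)
open B11Eq90V0primeBond (term39 V0primeP dV0primeBond dV0primeBond_apply contDiff_V0primeP contDiff_term39)
open B11Eq92CommutatorFunctional (dTerm39Bond dTerm39Bond_apply)
open Summit.QuantumFields.YangMills.Theorems.K0Stub1V0Reality (conj_wil prodCfg_inv_eq_star)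

variable {𝔸 : Type*} [NormedRing 𝔸] [NormedAlgebra ℂ 𝔸] [CompleteSpace 𝔸] [StarRing 𝔸] [ContinuousStar 𝔸] [StarModule ℂ 𝔸]
variable {S : Type*} {ι : Type*} (T : ι → Equiv.Perm S) (U : ι → S → 𝔸ˣ)

/-! ## §1 Hermitian letters at a unitary reading -/

omit [NormedAlgebra ℂ 𝔸] [CompleteSpace 𝔸] [ContinuousStar 𝔸] [StarModule ℂ 𝔸] in
/-- **THE FOUR TRANSPORTED LETTERS OF A HERMITIAN CONFIGURATION ARE HERMITIAN** at a unitary reading (`(R(U)X)* = R(U)X*`).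
[cite: Balaban1985BackgroundPropagators, (3.5) p.391, p.391 («functions with values in hermitian matrices»)] -/
theorem star_mem_lettersA (hU : ∀ μ x, (((U μ x)⁻¹ : 𝔸ˣ) : 𝔸) = star (U μ x : 𝔸)) {B : ι → S → 𝔸} (hB : ∀ κ y, star (B κ y) = B κ y)
    (μ ν : ι) (x : S) : ∀ a ∈ lettersA T U B μ ν x, star a = a := by
  intro a ha
  simp only [lettersA, List.mem_cons, List.not_mem_nil, or_false] at ha
  rcases ha with rfl | rfl | rfl | rfl
  · rw [star_neg, star_R (hU _ _), hB]
  · rw [star_neg, hB]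
  · rw [hB]
  · rw [star_R (hU _ _), hB]

omit [CompleteSpace 𝔸] [ContinuousStar 𝔸] in
/-- `X = η⁻¹ΣB′ₖ` is Hermitian and `C = Σ_{j<k}[B′_j, B′_k]` anti-Hermitian for Hermitian `B` at a unitary reading.
[cite: Balaban1985BackgroundPropagators, (3.6)–(3.7) p.391] -/
theorem star_plaqD_commSum_lettersA (hU : ∀ μ x, (((U μ x)⁻¹ : 𝔸ˣ) : 𝔸) = star (U μ x : 𝔸)) (η : ℝ) {B : ι → S → 𝔸}
    (hB : ∀ κ y, star (B κ y) = B κ y) (μ ν : ι) (x : S) :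
    star (plaqD η (lettersA T U B μ ν x)) = plaqD η (lettersA T U B μ ν x) ∧
      star (commSum (lettersA T U B μ ν x)) = -commSum (lettersA T U B μ ν x) := by
  obtain ⟨hsum, hC⟩ := star_sum_commSum (lettersA T U B μ ν x) (star_mem_lettersA T U hU hB μ ν x)
  exact ⟨by rw [plaqD, star_smul, star_eta_inv, hsum], hC⟩

omit [NormedAlgebra ℂ 𝔸] [CompleteSpace 𝔸] [ContinuousStar 𝔸] [StarModule ℂ 𝔸] in
/-- `comm2` of four Hermitian elements is anti-Hermitian (`[a, b]* = [b*, a*] = −[a, b]`). [cite: Balaban1985Variational, (39) p.284] -/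
theorem star_comm2_of_star_eq {b₀ b₁ b₂ b₃ : 𝔸} (h₀ : star b₀ = b₀) (h₁ : star b₁ = b₁) (h₂ : star b₂ = b₂) (h₃ : star b₃ = b₃) :
    star (B11Eq34BCH.comm2 b₀ b₁ b₂ b₃) = -B11Eq34BCH.comm2 b₀ b₁ b₂ b₃ := by
  simp only [B11Eq34BCH.comm2, Ring.lie_def, star_add, star_sub, star_mul, h₀, h₁, h₂, h₃]
  abel

/-! ## §2 Reality of `rem3`, `term39`, `V′₀` at Hermitian configurations -/

omit [StarRing 𝔸] [ContinuousStar 𝔸] [StarModule ℂ 𝔸] in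
/-- **THE REMAINDER FUNCTIONAL IN CLOSED FORM** (✓`eq37_summand` solved for the remainder): `rem3(B, ∂p) = wil τ(Πe^{iηB′}W) − wil τ W − η²τ(X·Im W)
− ½η⁴τ(X²·Re W) − ½η²τ(iC·Im W)`, `W = U₀(∂p)`. [cite: Balaban1985BackgroundPropagators, (3.7) p.391] -/
theorem rem3_eq_wil_sub (τ : 𝔸 →ₗ[ℂ] ℂ) (hτ : ∀ a b : 𝔸, τ (a * b) = τ (b * a)) (η : ℝ) (B : ι → S → 𝔸) (μ ν : ι) (x : S) :
    rem3 T U η τ B μ ν x =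
      wil τ (holU (letters η (lettersA T U B μ ν x)) * plaqU T U μ ν x) - wil τ (plaqU T U μ ν x)
        - (η : ℂ) ^ 2 * τ (plaqD η (lettersA T U B μ ν x) * imC (plaqU T U μ ν x))
        - 2⁻¹ * (η : ℂ) ^ 4 * τ (plaqD η (lettersA T U B μ ν x) * plaqD η (lettersA T U B μ ν x) * reC (plaqU T U μ ν x))
        - 2⁻¹ * (η : ℂ) ^ 2 * τ ((I • commSum (lettersA T U B μ ν x)) * imC (plaqU T U μ ν x)) := by
  have h37 := eq37_summand τ hτ η (lettersA T U B μ ν x) (plaqU T U μ ν x)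
  have hrem : rem3 T U η τ B μ ν x = -(2 : ℂ)⁻¹ * (τ (rem (letters η (lettersA T U B μ ν x)) * (plaqU T U μ ν x : 𝔸))
      + τ ((((plaqU T U μ ν x)⁻¹ : 𝔸ˣ) : 𝔸) * rem (invPath (letters η (lettersA T U B μ ν x))))) := rfl
  rw [hrem]
  linear_combination -h37

/-- ★ **`rem3(B, ∂p)` IS REAL** for Hermitian `B`, a unitary reading and a tracial `*`-compatible `τ`. [cite: Balaban1985BackgroundPropagators, (3.7) p.391, p.391] -/
theorem conj_rem3 (hU : ∀ μ x, (((U μ x)⁻¹ : 𝔸ˣ) : 𝔸) = star (U μ x : 𝔸)) (τ : 𝔸 →ₗ[ℂ] ℂ) (hτ : ∀ a b : 𝔸, τ (a * b) = τ (b * a))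
    (hτs : ∀ a : 𝔸, τ (star a) = starRingEnd ℂ (τ a)) (η : ℝ) {B : ι → S → 𝔸} (hB : ∀ κ y, star (B κ y) = B κ y) (μ ν : ι) (x : S) :
    starRingEnd ℂ (rem3 T U η τ B μ ν x) = rem3 T U η τ B μ ν x := by
  have hW := plaqU_unitary T U hU μ ν x
  obtain ⟨hX, hC⟩ := star_plaqD_commSum_lettersA T U hU η hB μ ν x
  obtain ⟨c1, c2, c3⟩ := coefficients_real hW τ hτ hτs hX hC
  have hwil1 : starRingEnd ℂ (wil τ (holU (letters η (lettersA T U B μ ν x)) * plaqU T U μ ν x))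
      = wil τ (holU (letters η (lettersA T U B μ ν x)) * plaqU T U μ ν x) := by
    rw [← wil_plaqU_prodCfg T U τ hτ η B μ ν x]
    exact conj_wil (plaqU_unitary T (prodCfg U η B) (prodCfg_inv_eq_star U hU η hB) μ ν x) τ hτs
  have hwil2 := conj_wil hW τ hτs
  rw [rem3_eq_wil_sub T U τ hτ]
  simp only [map_sub, map_mul, map_pow, Complex.conj_ofReal, map_inv₀, map_ofNat, hwil1, hwil2, c1, c2, c3]

omit [CompleteSpace 𝔸] [ContinuousStar 𝔸] in
/-- ★ **THE (39)-TERM IS REAL** for Hermitian `B`, a unitary reading and a tracial `*`-compatible `τ`: `(D^ηB)(p)` is Hermitian, `comm2` anti-Hermitian, so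
`τ((D^ηB)(p)·comm2)` is imaginary and `½ i τ(…)` real. [cite: Balaban1985Variational, (39) p.284] -/
theorem conj_term39 (hU : ∀ μ x, (((U μ x)⁻¹ : 𝔸ˣ) : 𝔸) = star (U μ x : 𝔸)) (τ : 𝔸 →ₗ[ℂ] ℂ) (hτ : ∀ a b : 𝔸, τ (a * b) = τ (b * a))
    (hτs : ∀ a : 𝔸, τ (star a) = starRingEnd ℂ (τ a)) (η : ℝ) {B : ι → S → 𝔸} (hB : ∀ κ y, star (B κ y) = B κ y) (μ ν : ι) (x : S) :
    starRingEnd ℂ (term39 T U η τ B μ ν x) = term39 T U η τ B μ ν x := by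
  have hY : star (curlη T U η B μ ν x) = curlη T U η B μ ν x := by
    have hB' : star B = B := funext fun κ => funext fun y => hB κ y
    have h := congrFun (congrFun (congrFun (star_curlη T U hU η B) μ) ν) x
    rw [hB'] at h
    exact h
  have hK := star_comm2_of_star_eq (𝔸 := 𝔸) (b₀ := -(R (U ν x) (B μ (T ν x)))) (b₁ := -(B ν x)) (b₂ := B μ x) (b₃ := R (U μ x) (B ν (T μ x)))
    (by rw [star_neg, star_R (hU _ _), hB]) (by rw [star_neg, hB]) (hB μ x) (by rw [star_R (hU _ _), hB])
  unfold term39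
  rw [map_mul, map_mul, map_inv₀, map_ofNat, Complex.conj_I, ← hτs, star_mul, hY, hK, neg_mul, map_neg, hτ]
  ring

/-- ★★ **`V′₀(B, ∂p)` IS REAL** for Hermitian `B`, a unitary reading and a tracial `*`-compatible `τ` (`V′₀ = η⁻⁴·rem3 − term39`).
[cite: Balaban1985Variational, (39) p.284, (30) p.282] -/
theorem conj_V0primeP (hU : ∀ μ x, (((U μ x)⁻¹ : 𝔸ˣ) : 𝔸) = star (U μ x : 𝔸)) (τ : 𝔸 →ₗ[ℂ] ℂ) (hτ : ∀ a b : 𝔸, τ (a * b) = τ (b * a))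
    (hτs : ∀ a : 𝔸, τ (star a) = starRingEnd ℂ (τ a)) (η : ℝ) {B : ι → S → 𝔸} (hB : ∀ κ y, star (B κ y) = B κ y) (μ ν : ι) (x : S) :
    starRingEnd ℂ (V0primeP T U η τ B μ ν x) = V0primeP T U η τ B μ ν x := by
  unfold V0primeP V0p
  rw [map_sub, map_mul, map_pow, map_inv₀, Complex.conj_ofReal, conj_rem3 T U hU τ hτ hτs η hB, conj_term39 T U hU τ hτ hτs η hB]

/-! ## §3 The one-bond functionals are real on Hermitian data -/

variable [DecidableEq S] [LinearOrder ι]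

omit [NormedAlgebra ℂ 𝔸] [CompleteSpace 𝔸] [ContinuousStar 𝔸] [StarModule ℂ 𝔸] in
/-- The one-bond variation `δ_b Z` of a Hermitian `Z` is Hermitian-valued. [cite: Balaban1985Variational, (63) p.287] -/
theorem star_bondDelta {Z : 𝔸} (hZ : star Z = Z) (μ₀ : ι) (x₀ : S) : ∀ κ y, star (bondDelta μ₀ x₀ Z κ y) = bondDelta μ₀ x₀ Z κ y := by
  intro κ y
  unfold bondDelta
  split_ifs
  · exact hZ
  · exact star_zero 𝔸

variable [Fintype S] [Fintype ι]

/-- ★★ **THE ONE-BOND FUNCTIONAL OF `V′₀` IS REAL ON HERMITIAN DATA**: for a unitary reading, a tracial `*`-compatible continuous `τ`, a Hermitian-valued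
configuration `A` and a Hermitian `Z`, `conj(((∂/∂A(b))V′₀)(A, ∂q)·Z) = ((∂/∂A(b))V′₀)(A, ∂q)·Z` (the derivative at `0` of an entire function that is real on the
real axis). [cite: Balaban1985Variational, (90) p.291, (63) p.287, (39) p.284] -/
theorem conj_dV0primeBond_apply (hU : ∀ μ x, (((U μ x)⁻¹ : 𝔸ˣ) : 𝔸) = star (U μ x : 𝔸)) (τ : 𝔸 →L[ℂ] ℂ) (hτ : ∀ a b : 𝔸, τ (a * b) = τ (b * a))
    (hτs : ∀ a : 𝔸, τ (star a) = starRingEnd ℂ (τ a)) (η : ℝ) {A : ι → S → 𝔸} (hA : ∀ κ y, star (A κ y) = A κ y) (q : S × ι × ι)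
    (μ₀ : ι) (x₀ : S) {Z : 𝔸} (hZ : star Z = Z) :
    starRingEnd ℂ (dV0primeBond T U η τ A q μ₀ x₀ Z) = dV0primeBond T U η τ A q μ₀ x₀ Z := by
  rw [dV0primeBond_apply]
  set f : ℂ → ℂ := fun t => V0primeP T U η (τ : 𝔸 →ₗ[ℂ] ℂ) (A + t • bondDelta μ₀ x₀ Z) q.2.1 q.2.2 q.1 with hf_def
  have hf : Differentiable ℂ f :=
    ((contDiff_V0primeP T U (n := 1) η τ q.2.1 q.2.2 q.1).differentiable (by norm_num)).comp
      ((differentiable_const A).add (differentiable_id.smul_const _))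
  have hreal : ∀ t : ℝ, (f (t : ℂ)).im = 0 := fun t =>
    Complex.conj_eq_iff_im.1 (conj_V0primeP T U hU (τ : 𝔸 →ₗ[ℂ] ℂ) hτ hτs η (B := A + (t : ℂ) • bondDelta μ₀ x₀ Z)
      (fun κ y => star_line hA (star_bondDelta hZ μ₀ x₀) t κ y) q.2.1 q.2.2 q.1)
  have hd : HasDerivAt f (deriv f 0) ((0 : ℝ) : ℂ) := by
    rw [Complex.ofReal_zero]
    exact (hf 0).hasDerivAt
  exact Complex.conj_eq_iff_im.2 (Literature.Analysis.SpecialFunctions.im_deriv_eq_zero_of_real hd (Eventually.of_forall hreal))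

omit [CompleteSpace 𝔸] [ContinuousStar 𝔸] in
/-- ★ **THE ONE-BOND FUNCTIONAL OF THE (39)-TERM IS REAL ON HERMITIAN DATA** (same hypotheses). [cite: Balaban1985Variational, (91)–(93) p.292, (63) p.287] -/
theorem conj_dTerm39Bond_apply (hU : ∀ μ x, (((U μ x)⁻¹ : 𝔸ˣ) : 𝔸) = star (U μ x : 𝔸)) (τ : 𝔸 →L[ℂ] ℂ) (hτ : ∀ a b : 𝔸, τ (a * b) = τ (b * a))
    (hτs : ∀ a : 𝔸, τ (star a) = starRingEnd ℂ (τ a)) (η : ℝ) {A : ι → S → 𝔸} (hA : ∀ κ y, star (A κ y) = A κ y) (q : S × ι × ι)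
    (μ₀ : ι) (x₀ : S) {Z : 𝔸} (hZ : star Z = Z) :
    starRingEnd ℂ (dTerm39Bond T U η τ A q μ₀ x₀ Z) = dTerm39Bond T U η τ A q μ₀ x₀ Z := by
  rw [dTerm39Bond_apply]
  set f : ℂ → ℂ := fun t => term39 T U η (τ : 𝔸 →ₗ[ℂ] ℂ) (A + t • bondDelta μ₀ x₀ Z) q.2.1 q.2.2 q.1 with hf_def
  have hf : Differentiable ℂ f :=
    ((contDiff_term39 T U (n := 1) η τ q.2.1 q.2.2 q.1).differentiable (by norm_num)).comp
      ((differentiable_const A).add (differentiable_id.smul_const _))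
  have hreal : ∀ t : ℝ, (f (t : ℂ)).im = 0 := fun t =>
    Complex.conj_eq_iff_im.1 (conj_term39 T U hU (τ : 𝔸 →ₗ[ℂ] ℂ) hτ hτs η (B := A + (t : ℂ) • bondDelta μ₀ x₀ Z)
      (fun κ y => star_line hA (star_bondDelta hZ μ₀ x₀) t κ y) q.2.1 q.2.2 q.1)
  have hd : HasDerivAt f (deriv f 0) ((0 : ℝ) : ℂ) := by
    rw [Complex.ofReal_zero]
    exact (hf 0).hasDerivAt
  exact Complex.conj_eq_iff_im.2 (Literature.Analysis.SpecialFunctions.im_deriv_eq_zero_of_real hd (Eventually.of_forall hreal))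

end Summit.QuantumFields.YangMills.Theorems.Prop7V0CurrentHermitianReality

end
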